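/-
Origin: expansion seat `prover-pub-hodgecm-mc-binder-2-g14-0`, handover #S5 2026-08-20T12:17Z md5 eb8d4b0ebc2a (PKG 24662ac4e753 → eb8d4b0ebc2a; 168 l.; σ implicit; proofs verbatim) (`HOME/mc/pub-hodgecm-mc-binder-2/g14/s5b/HodgeCM/Model/HypCensus/DensePlaceEmb.lean`, md5 eb8d4b0ebc2a, 168 lines);
landed by the gen-20 packager (p-g20) in gate run 51 REPLACES the earlier landed copy of `HodgeCM/Model/HypCensus/DensePlaceEmb.lean` (seat copy carried the packager Origin header of an earlier run (stripped)).
-/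
/-
Copyright (c) 2026. All rights reserved.
Released under Apache 2.0 license as described in the file LICENSE.
-/
import Summits.HodgeConjecture.HodgeCM.Model.HypCensus.DensePlaceRange

/-!
# (J-dense), step (iv-b) at the pin, concluded: every per-place letter eigenvector is an embedded printed vector

Binder-2 lineage, rows 18/19 (`hyp12`/`hyp34`), field `dense` of `HypCoreW`.  Continuation of `DensePlaceRange` (the place under
`ι₁` and the `Σ₁₂` places with `V` read positive): the `Σ₁₂` places with `V` read negative (#64) and the `D₁₂` places (#65), and the
case split of #29's `datumAt`:

* **`mem_range_embOf_of_mem_jointEigenspace`**: for every infinite place `b` of `L` and every joint eigenvector `p ∈ ℂ[Fin 6]` of the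
  pin's letter substitutions at `w = cmPlacesEquiv L b` (eigenvalues `pinPlaceEig`), `p ∈ range (embOf … (datumAtσ V S jD (jIOf V S hW) σ) m₁ m₂ b)`.

With #63 this says: every `K_∞`-isotypic polynomial of the pin is a sum of place products of embedded printed vectors, i.e. lies in the
range of the printed insertion `insPoly` — the next leaf (`DenseRange`).  [GoodmanWallach2009 §§4.2.1, 5.2.1; folklore]
Nothing here is a claim of PerL/QW8.
-/

noncomputable section

open NumberField NumberField.InfinitePlace IsDedekindDomain
open scoped Matrix Classical TensorProduct
open MvPolynomial
open Literature.NumberTheory.Automorphic Literature.NumberTheory.Automorphic.UnitaryGroup Literature.NumberTheory.Weil1964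
open Literature.RepresentationTheory.KonnoKonno2007 Literature.RepresentationTheory.KonnoKonno2007.RealDualPair
open Literature.NumberTheory.GelbartRogawski1991 Literature.NumberTheory.GelbartRogawski1991.UnitaryDualPair
open Literature.Analysis.SegalBargmann Literature.RepresentationTheory
open HodgeCM HodgeCM.Model
open HodgeCM.PerL34.Fock HodgeCM.PerL34.Fock.PrintDict

namespace HodgeCM.Model.HypCensus

section Range

variable {L : CMField} {ι₁ : L →+* ℂ} (V : HermSpace3 L ι₁) (S : StubTree.SeesawDatum L)
variable (hW : (∀ j, 0 < (ι₁ ((dW S) j)).re) ∨ ∀ j, (ι₁ ((dW S) j)).re < 0)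
variable (jD : InfinitePlace (L : Type) → HodgeCM.PerL34.Fock.EqVar → Fin 6) (m₁ m₂ : InfinitePlace (L : Type) → ℤ)
variable {σ : InfinitePlace (L : Type) → Equiv.Perm (Fin 2)}

/-- **a `Σ₁₂` place with `V` read negative.** -/
theorem mem_range_embOf_of_sigmaNeg (b : InfinitePlace (L : Type)) (hb : cmPlacesEquiv (L : Type) b ≠ cmPlace (L : Type) ι₁)
    (hsig : Nonempty (PosIdx (cmXW (L : Type) (frameD V) (dW S) (dW_real S) ι₁ (cmPlacesEquiv (L : Type) b))) ∧
      Nonempty (NegIdx (cmXW (L : Type) (frameD V) (dW S) (dW_real S) ι₁ (cmPlacesEquiv (L : Type) b))))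
    (hQ : ¬ IsEmpty (NegIdx (cmXV (L : Type) (frameD V) (frameD_real V) ι₁ (cmPlacesEquiv (L : Type) b))))
    {p : MvPolynomial (Fin 6) ℂ}
    (hp : p ∈ jointEigenspace (fun a : VLetterFam V => (pinPlaceOp V S (cmPlacesEquiv (L : Type) b) a).toLinearMap)
      (pinPlaceEig V S (cmPlacesEquiv (L : Type) b))) :
    p ∈ LinearMap.range (embOf (L : Type) (frameD V) (frameD_real V) (dW S) (dW_real S) ι₁ (datumAtσ V S jD (jIOf V S hW) σ) m₁ m₂ b) := by
  have hP : IsEmpty (PosIdx (cmXV (L : Type) (frameD V) (frameD_real V) ι₁ (cmPlacesEquiv (L : Type) b))) :=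
    (isEmpty_posIdx_or_negIdx_cmXV V b hb).resolve_right hQ
  haveI := hP
  have hsub := subsingleton_posIdx_negIdx_two hsig.1 hsig.2
  haveI := hsub.1
  haveI := hsub.2
  letI : Unique (PosIdx (cmXW (L : Type) (frameD V) (dW S) (dW_real S) ι₁ (cmPlacesEquiv (L : Type) b))) :=
    uniqueOfSubsingleton (Classical.choice hsig.1)
  letI : Unique (NegIdx (cmXW (L : Type) (frameD V) (dW S) (dW_real S) ι₁ (cmPlacesEquiv (L : Type) b))) :=
    uniqueOfSubsingleton (Classical.choice hsig.2)
  haveI : Nonempty (NegIdx (cmXV (L : Type) (frameD V) (frameD_real V) ι₁ (cmPlacesEquiv (L : Type) b))) :=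
    ⟨((cmEpsV (L : Type) (frameD V) (frameD_real V) ι₁ (cmPlacesEquiv (L : Type) b)).trans (@Equiv.emptySum _ _ hP)) 0⟩
  have hinv : ∀ d : Matrix.unitaryGroup (NegIdx (cmXV (L : Type) (frameD V) (frameD_real V) ι₁ (cmPlacesEquiv (L : Type) b))) ℂ,
      linSubst (star ((dualPairι ((((1 : Matrix.unitaryGroup (PosIdx (cmXV (L : Type) (frameD V) (frameD_real V) ι₁
          (cmPlacesEquiv (L : Type) b))) ℂ), d), (1, 1)) :
          DPK (PosIdx (cmXV (L : Type) (frameD V) (frameD_real V) ι₁ (cmPlacesEquiv (L : Type) b)))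
            (NegIdx (cmXV (L : Type) (frameD V) (frameD_real V) ι₁ (cmPlacesEquiv (L : Type) b)))
            (PosIdx (cmXW (L : Type) (frameD V) (dW S) (dW_real S) ι₁ (cmPlacesEquiv (L : Type) b)))
            (NegIdx (cmXW (L : Type) (frameD V) (dW S) (dW_real S) ι₁ (cmPlacesEquiv (L : Type) b)))) :
          Matrix.unitaryGroup _ ℂ) : Matrix _ _ ℂ)) (rename (pinPairFrame V S (cmPlacesEquiv (L : Type) b)) p) =
        rename (pinPairFrame V S (cmPlacesEquiv (L : Type) b)) p := fun d => by
    have := linSubst_dualPairι_framePoly V S (cmPlacesEquiv (L : Type) b) hp (1, d)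
    rwa [Pi.mulSingle_eq_of_ne (Ne.symm hb), dVIota_one, one_smul] at this
  have hG := (kV_invariant_iff_mem_span_slotPairingNeg_pow (Classical.choice hsig.1) (Classical.choice hsig.2) _).mp hinv
  -- the two (T12) orientations share the variable identification `idx`; prove the span membership once
  suffices key : p ∈ Submodule.span ℂ (Set.range fun k : ℕ => rename ((PlaceDatum.sigmaNeg ((cmEpsV (L : Type) (frameD V) (frameD_real V) ι₁
        (cmPlacesEquiv (L : Type) b)).trans (@Equiv.emptySum _ _ hP)) hP (Classical.choice hsig.1) (Classical.choice hsig.2) hsub.1 hsub.2 :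
          PlaceDatum (L : Type) (frameD V) (frameD_real V) (dW S) (dW_real S) ι₁ (cmPlacesEquiv (L : Type) b)).idx)
        (HodgeCM.PerL34.Fock.P ^ k)) by
    by_cases hs : σ b (Classical.choice hsig.2).1 = 0
    · exact mem_range_emb_of_eq_sigmaNeg (L : Type) (frameD V) (frameD_real V) (dW S) (dW_real S) ι₁ _ _ hP _ _ hsub.1 hsub.2 _
        (datumAt_of_sigmaNeg V S jD (jIOf V S hW) b hb hsig hQ hs) _ p key
    · exact mem_range_emb_of_eq_sigmaNegSwap (L : Type) (frameD V) (frameD_real V) (dW S) (dW_real S) ι₁ _ _ hP _ _ hsub.1 hsub.2 _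
        (datumAt_of_sigmaNegSwap V S jD (jIOf V S hW) b hb hsig hQ hs) _ p key
  have hidx : ((PlaceDatum.sigmaNeg ((cmEpsV (L : Type) (frameD V) (frameD_real V) ι₁ (cmPlacesEquiv (L : Type) b)).trans
      (@Equiv.emptySum _ _ hP)) hP (Classical.choice hsig.1) (Classical.choice hsig.2) hsub.1 hsub.2 :
        PlaceDatum (L : Type) (frameD V) (frameD_real V) (dW S) (dW_real S) ι₁ (cmPlacesEquiv (L : Type) b)).idx :
      HodgeCM.PerL34.Fock.MixedVar → Fin 6) =
      (pinPairFrame V S (cmPlacesEquiv (L : Type) b)).symm ∘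
        mixedToDPIdxNeg (PosIdx (cmXV (L : Type) (frameD V) (frameD_real V) ι₁ (cmPlacesEquiv (L : Type) b)))
          ((cmEpsV (L : Type) (frameD V) (frameD_real V) ι₁ (cmPlacesEquiv (L : Type) b)).trans (@Equiv.emptySum _ _ hP))
          (Classical.choice hsig.1) (Classical.choice hsig.2) := by
    funext x
    change (cmIdx (L : Type) (frameD V) (frameD_real V) (dW S) (dW_real S) ι₁ (cmPlacesEquiv (L : Type) b)).symm (mixedToDPIdxNeg _ _ _ _ x) = _
    rw [cmIdx_eq_pairFrame]
    rfl
  have hle : (Submodule.span ℂ (Set.range fun k : ℕ => slotPairingNeg (P' := PosIdx (cmXV (L : Type) (frameD V) (frameD_real V) ι₁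
      (cmPlacesEquiv (L : Type) b))) (Classical.choice hsig.1) (Classical.choice hsig.2) ^ k)).map
      (rename (pinPairFrame V S (cmPlacesEquiv (L : Type) b)).symm).toLinearMap ≤
      Submodule.span ℂ (Set.range fun k : ℕ => rename ((PlaceDatum.sigmaNeg ((cmEpsV (L : Type) (frameD V) (frameD_real V) ι₁
        (cmPlacesEquiv (L : Type) b)).trans (@Equiv.emptySum _ _ hP)) hP (Classical.choice hsig.1) (Classical.choice hsig.2) hsub.1 hsub.2 :
          PlaceDatum (L : Type) (frameD V) (frameD_real V) (dW S) (dW_real S) ι₁ (cmPlacesEquiv (L : Type) b)).idx)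
        (HodgeCM.PerL34.Fock.P ^ k)) := by
    rw [Submodule.map_span, ← Set.range_comp]
    refine le_of_eq (congrArg _ (congrArg _ (funext fun k => ?_)))
    rw [Function.comp_apply, AlgHom.toLinearMap_apply]
    refine Eq.trans ?_ (congrArg (fun j => rename j (HodgeCM.PerL34.Fock.P ^ k)) hidx).symm
    rw [← rename_rename, map_pow, map_pow, rename_mixedToDPIdxNeg_P, map_pow]
    rfl
  rw [eq_rename_symm_rename V S (cmPlacesEquiv (L : Type) b) p]
  exact hle (Submodule.mem_map_of_mem hG)

/-- **a `D₁₂` place** (both `V_b`, `W_b` definite). -/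
theorem mem_range_embOf_of_delta (b : InfinitePlace (L : Type)) (hb : cmPlacesEquiv (L : Type) b ≠ cmPlace (L : Type) ι₁)
    (hsig : ¬ (Nonempty (PosIdx (cmXW (L : Type) (frameD V) (dW S) (dW_real S) ι₁ (cmPlacesEquiv (L : Type) b))) ∧
      Nonempty (NegIdx (cmXW (L : Type) (frameD V) (dW S) (dW_real S) ι₁ (cmPlacesEquiv (L : Type) b)))))
    {p : MvPolynomial (Fin 6) ℂ}
    (hp : p ∈ jointEigenspace (fun a : VLetterFam V => (pinPlaceOp V S (cmPlacesEquiv (L : Type) b) a).toLinearMap)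
      (pinPlaceEig V S (cmPlacesEquiv (L : Type) b))) :
    p ∈ LinearMap.range (embOf (L : Type) (frameD V) (frameD_real V) (dW S) (dW_real S) ι₁ (datumAtσ V S jD (jIOf V S hW) σ) m₁ m₂ b) := by
  have hRS : IsEmpty (PosIdx (cmXW (L : Type) (frameD V) (dW S) (dW_real S) ι₁ (cmPlacesEquiv (L : Type) b))) ∨
      IsEmpty (NegIdx (cmXW (L : Type) (frameD V) (dW S) (dW_real S) ι₁ (cmPlacesEquiv (L : Type) b))) := by
    rcases not_and_or.mp hsig with h | h
    · exact Or.inl (not_nonempty_iff.mp h)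
    · exact Or.inr (not_nonempty_iff.mp h)
  have hinv : ∀ (a : Matrix.unitaryGroup (PosIdx (cmXV (L : Type) (frameD V) (frameD_real V) ι₁ (cmPlacesEquiv (L : Type) b))) ℂ)
      (d : Matrix.unitaryGroup (NegIdx (cmXV (L : Type) (frameD V) (frameD_real V) ι₁ (cmPlacesEquiv (L : Type) b))) ℂ),
      linSubst (star ((dualPairι (((a, d), (1, 1)) :
          DPK (PosIdx (cmXV (L : Type) (frameD V) (frameD_real V) ι₁ (cmPlacesEquiv (L : Type) b)))
            (NegIdx (cmXV (L : Type) (frameD V) (frameD_real V) ι₁ (cmPlacesEquiv (L : Type) b)))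
            (PosIdx (cmXW (L : Type) (frameD V) (dW S) (dW_real S) ι₁ (cmPlacesEquiv (L : Type) b)))
            (NegIdx (cmXW (L : Type) (frameD V) (dW S) (dW_real S) ι₁ (cmPlacesEquiv (L : Type) b)))) :
          Matrix.unitaryGroup _ ℂ) : Matrix _ _ ℂ)) (rename (pinPairFrame V S (cmPlacesEquiv (L : Type) b)) p) =
        rename (pinPairFrame V S (cmPlacesEquiv (L : Type) b)) p := fun a d => by
    have := linSubst_dualPairι_framePoly V S (cmPlacesEquiv (L : Type) b) hp (a, d)
    rwa [Pi.mulSingle_eq_of_ne (Ne.symm hb), dVIota_one, one_smul] at this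
  have hC := eq_C_of_kV_invariant_of_definite hRS _ hinv
  rw [eq_rename_symm_rename V S (cmPlacesEquiv (L : Type) b) p, hC, rename_C]
  exact C_mem_range_emb_of_kind_delta (L : Type) (frameD V) (frameD_real V) (dW S) (dW_real S) ι₁ _ _
    (datumAt_kind_of_delta V S jD (jIOf V S hW) b hb hsig) _ _

/-- **(J-dense)(iv-b) AT THE PIN: every per-place letter eigenvector is an embedded printed vector.**  For every infinite place `b`
of `L` and every `p ∈ ℂ[Fin 6]` in the joint eigenspace of the pin's place-`w` letter substitutions (`w = cmPlacesEquiv L b`, eigenvalues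
`pinPlaceEig`: `1` off `ι₁`, `dVIota` at `ι₁`), `p` lies in the range of the printed embedding `embOf … (datumAt …) b` of the chosen
place data: the printed local modules `ℂ[P]` (`Σ₁₂`), `ℂ·1` (`D₁₂`), `ℂ·det z` (`ι₁`) ARE the full eigenspaces (#20/#64, #65, #66/#67). -/
theorem mem_range_embOf_of_mem_jointEigenspace (b : InfinitePlace (L : Type)) {p : MvPolynomial (Fin 6) ℂ}
    (hp : p ∈ jointEigenspace (fun a : VLetterFam V => (pinPlaceOp V S (cmPlacesEquiv (L : Type) b) a).toLinearMap)
      (pinPlaceEig V S (cmPlacesEquiv (L : Type) b))) :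
    p ∈ LinearMap.range (embOf (L : Type) (frameD V) (frameD_real V) (dW S) (dW_real S) ι₁ (datumAtσ V S jD (jIOf V S hW) σ) m₁ m₂ b) := by
  by_cases hb : cmPlacesEquiv (L : Type) b = cmPlace (L : Type) ι₁
  · exact mem_range_embOf_of_eq V S hW jD m₁ m₂ b hb hp
  · by_cases hsig : Nonempty (PosIdx (cmXW (L : Type) (frameD V) (dW S) (dW_real S) ι₁ (cmPlacesEquiv (L : Type) b))) ∧
        Nonempty (NegIdx (cmXW (L : Type) (frameD V) (dW S) (dW_real S) ι₁ (cmPlacesEquiv (L : Type) b)))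
    · by_cases hQ : IsEmpty (NegIdx (cmXV (L : Type) (frameD V) (frameD_real V) ι₁ (cmPlacesEquiv (L : Type) b)))
      · exact mem_range_embOf_of_sigmaPos V S hW jD m₁ m₂ b hb hsig hQ hp
      · exact mem_range_embOf_of_sigmaNeg V S hW jD m₁ m₂ b hb hsig hQ hp
    · exact mem_range_embOf_of_delta V S hW jD m₁ m₂ b hb hsig hp

end Range

end HodgeCM.Model.HypCensus

end
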